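import Mathlib.RingTheory.MvPolynomial.Basic
import Mathlib.Algebra.MvPolynomial.Degrees
import Mathlib.Analysis.SpecialFunctions.Pow.Real
import Mathlib.Data.Complex.Basic
import HarnessLib

/-!
# Bombieri–Pila: integral points on an absolutely irreducible plane curve

Named fact (D-0014) requested by route Parity/PolynomialMobius (`wi-05060`, item
`stmt-Parity-0874` `LambdaToCount`: proper prime-power values `f(n) = p^a`, `a ≥ 2`, of a
polynomial of degree `≥ 3` are `O(x^{1/2+ε})` in number, via integral points on `y^a = f(x)`).

Source: E. Bombieri, J. Pila, *The number of integral points on arcs and ovals*, Duke Math. J.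
59 (1989) 337–357, **Theorem 5**: let `C` be an absolutely irreducible algebraic curve of degree
`d ≥ 2` (in the real plane) and `N ≥ exp(d⁶)`; then the number of integral points on `C` inside a
square of side `N` is at most `N^{1/d} exp(12 √(d log N log log N))`. In particular, for every
`ε > 0` the count is `≤ B(d, ε) N^{1/d + ε}` for all `N ≥ 1` with `B` depending only on `d` and
`ε` (the finitely many `N < exp(d⁶)` are absorbed by Bézout / the trivial bound `(2N+1)²`, which
depends only on `d`). This uniform-in-the-curve `N^{1/d+ε}` form is the one recorded here
(zbMATH 0718.11048: "for irreducible algebraic curves of degree `d`, (1) holds with `θ = 1/d`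
and `B(ε)` depending only on `d` (Theorem 5)").

## Design

* The curve is given by a polynomial `F ∈ ℤ[X, Y]` = `MvPolynomial (Fin 2) ℤ` (the paper allows
  real coefficients; integer coefficients are the case routes consume) of total degree `d`;
  *absolutely irreducible* = irreducible in `ℂ[X, Y]` after `MvPolynomial.map (algebraMap ℤ ℂ)`.
* The box is `[-N, N]²` (a translate of the paper's `[0, 2N]²`; translation preserves degree and
  absolute irreducibility, and the bound is uniform in the curve), as a `Finset` filter over
  `Finset.Icc (-N) N ×ˢ Finset.Icc (-N) N`, so the count is a natural number with no junk value.
* Exponent `1/d + ε` as a real power `Real.rpow`.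

## References

* E. Bombieri, J. Pila, *The number of integral points on arcs and ovals*, Duke Math. J. 59
  (1989) 337–357, Theorem 5 [BombieriPila1989].
-/

namespace Literature.NumberTheory.DiophantineGeometry.Dioph

open MvPolynomial

/-- The integral points of the plane curve `F = 0`, `F ∈ ℤ[X, Y]`, in the box `[-N, N]²`.
[folklore] -/
noncomputable def integralPointsInBox (F : MvPolynomial (Fin 2) ℤ) (N : ℕ) : Finset (ℤ × ℤ) :=
  (Finset.Icc (-(N : ℤ)) N ×ˢ Finset.Icc (-(N : ℤ)) N).filter
    fun p => MvPolynomial.eval ![p.1, p.2] F = 0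

/-- `F ∈ ℤ[X, Y]` is **absolutely irreducible**: irreducible as a polynomial over `ℂ`.
[folklore] -/
def IsAbsolutelyIrreducible (F : MvPolynomial (Fin 2) ℤ) : Prop :=
  Irreducible (MvPolynomial.map (algebraMap ℤ ℂ) F)

/-- **Bombieri–Pila (1989), Theorem 5** (uniform bound for integral points on curves). For every
degree `d ≥ 2` and every `ε > 0` there is a constant `B = B(d, ε) > 0` such that for every
absolutely irreducible `F ∈ ℤ[X, Y]` of total degree `d` and every `N ≥ 1`,
`#{(x, y) ∈ ℤ² : |x|, |y| ≤ N, F(x, y) = 0} ≤ B · N^{1/d + ε}`. The constant does not depend on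
`F`. [cite: BombieriPila1989, Theorem 5] -/
def bombieriPila_card_integralPointsInBox_le : Prop :=
  ∀ d : ℕ, 2 ≤ d → ∀ ε : ℝ, 0 < ε → ∃ B : ℝ, 0 < B ∧
    ∀ F : MvPolynomial (Fin 2) ℤ, F.totalDegree = d → IsAbsolutelyIrreducible F →
      ∀ N : ℕ, 1 ≤ N →
        ((integralPointsInBox F N).card : ℝ) ≤ B * (N : ℝ) ^ (1 / (d : ℝ) + ε)

/-- Membership in `integralPointsInBox`, unfolded. [folklore] -/
theorem mem_integralPointsInBox {F : MvPolynomial (Fin 2) ℤ} {N : ℕ} {p : ℤ × ℤ} :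
    p ∈ integralPointsInBox F N ↔
      (|p.1| ≤ N ∧ |p.2| ≤ N) ∧ MvPolynomial.eval ![p.1, p.2] F = 0 := by
  simp [integralPointsInBox, Finset.mem_filter, Finset.mem_product, Finset.mem_Icc, abs_le]

/-- The trivial bound `#(C(ℤ) ∩ [-N, N]²) ≤ (2N+1)²`. [folklore] -/
theorem card_integralPointsInBox_le_sq (F : MvPolynomial (Fin 2) ℤ) (N : ℕ) :
    (integralPointsInBox F N).card ≤ (2 * N + 1) ^ 2 := by
  classical
  calc (integralPointsInBox F N).card
      ≤ (Finset.Icc (-(N : ℤ)) N ×ˢ Finset.Icc (-(N : ℤ)) N).card := Finset.card_filter_le _ _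
    _ = (2 * N + 1) ^ 2 := by
        rw [Finset.card_product, Int.card_Icc]
        have h : ((N : ℤ) + 1 - -(N : ℤ)).toNat = 2 * N + 1 := by omega
        rw [h]; ring

end Literature.NumberTheory.DiophantineGeometry.Dioph
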